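import Literature.AnabelianGeometry.SemiGraphs.TemperedFunctorialityWith
import Literature.AnabelianGeometry.SemiGraphs.ProfiniteSemiGraphIsoTransport
import Literature.AnabelianGeometry.SemiGraphs.CoveringGraphIsoOver
import HarnessLib

/-!
# Transport along equalities of vertices / edges / branches in a profinite presentation and in the
# fibres of an object of `B^cov` (route T, TRANSPORT IV — bookkeeping)

Mochizuki, *Semi-graphs of anabelioids*, Publ. RIMS **42** (2006), §2 Def. 2.1 p. 22 (the semi-graph
of profinite groups `Π_v`, `Π_e`, `b_*`), Rmk. 2.4.2 p. 26 (morphisms: the compatibilities with the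
branch maps hold up to conjugation — the 2-cells are data, cf. abc-iut-L3-d4's `Hom.ConjugatorFamily`),
§3 p. 36 (objects `{S_v, S_e, glue}` of `B^cov`) [cite: MochizukiSemiAnbd2006, Rmk 2.4.2 p.26].

Pure bookkeeping for the inverse of an isomorphism of profinite presentations
(`ProfiniteSemiGraphIsoInverse.lean`) and the pull-back equivalence
(`ProfiniteSemiGraphIsoPullbackEquivalence.lean`), where everything is indexed by `F (F⁻¹ w)` rather
than `w`: composites of the transports `castGv` / `castGe` (abc-iut-L3-t3, `SgATemperedArrows`); the
constituent homomorphisms `F_v`, `F_e`, the branch maps `b_*` and a family of 2-cells `θ` commute with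
transport; the compatibility square of `F` read at arbitrary targets (`ConjugatorFamily.comm_cast`);
transport of points of the VERTEX fibres of an object of `B^cov` (`CovObj.castPtV`, companion of
abc-iut-L3-t3's `CovObj.castPtE`) and its compatibility with the actions, the morphisms, the gluings and
the pull-back `F^*_θ`.  Every lemma is `subst; rfl`.  abc-iut cell, L3 route T · TRANSPORT (seat
abc-iut-L3-d6); nothing of the paper is asserted; nothing here bears on [IUTchIII] Cor. 3.12.
-/

noncomputable section

open CategoryTheory Topology

namespace Literature.AnabelianGeometry.SemiGraphs

namespace ProfiniteSemiGraph

universe u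

variable {X Y : ProfiniteSemiGraph.{u}}

/-! ### Transport in the constituent groups: composites, and `F_v`, `F_e`, `b_*`, `θ_b` commute with it -/

/-- Composite of two transports in the vertex groups. [cite: MochizukiSemiAnbd2006, Def. 2.1 p.23] -/
@[simp] theorem castGv_castGv {v₁ v₂ v₃ : X.graph.Vertex} (h₁ : v₁ = v₂) (h₂ : v₂ = v₃) (x : X.Gv v₁) :
    X.castGv h₂ (X.castGv h₁ x) = X.castGv (h₁.trans h₂) x := by
  subst h₁; subst h₂; rfl

/-- Composite of two transports in the edge groups. [cite: MochizukiSemiAnbd2006, Def. 2.1 p.23] -/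
@[simp] theorem castGe_castGe {e₁ e₂ e₃ : X.graph.Edge} (h₁ : e₁ = e₂) (h₂ : e₂ = e₃) (x : X.Ge e₁) :
    X.castGe h₂ (X.castGe h₁ x) = X.castGe (h₁.trans h₂) x := by
  subst h₁; subst h₂; rfl

/-- The inverse of a transport is the transport along the reversed equality.
[cite: MochizukiSemiAnbd2006, Def. 2.1 p.23] -/
@[simp] theorem castGv_symm_apply {v₁ v₂ : X.graph.Vertex} (h : v₁ = v₂) (x : X.Gv v₂) :
    (X.castGv h).symm x = X.castGv h.symm x := by
  subst h; rfl

/-- The inverse of a transport is the transport along the reversed equality.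
[cite: MochizukiSemiAnbd2006, Def. 2.1 p.23] -/
@[simp] theorem castGe_symm_apply {e₁ e₂ : X.graph.Edge} (h : e₁ = e₂) (x : X.Ge e₂) :
    (X.castGe h).symm x = X.castGe h.symm x := by
  subst h; rfl

/-- The vertex homomorphisms of a morphism commute with transport. [cite: MochizukiSemiAnbd2006, Rmk 2.4.2 p.26] -/
theorem Hom.hV_castGv (F : Hom X Y) {v₁ v₂ : X.graph.Vertex} (h : v₁ = v₂) (x : X.Gv v₁) :
    F.hV v₂ (X.castGv h x) = Y.castGv (congrArg F.base.vertexMap h) (F.hV v₁ x) := by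
  subst h; rfl

/-- The edge homomorphisms of a morphism commute with transport. [cite: MochizukiSemiAnbd2006, Rmk 2.4.2 p.26] -/
theorem Hom.hE_castGe (F : Hom X Y) {e₁ e₂ : X.graph.Edge} (h : e₁ = e₂) (x : X.Ge e₁) :
    F.hE e₂ (X.castGe h x) = Y.castGe (congrArg F.base.edgeMap h) (F.hE e₁ x) := by
  subst h; rfl

/-- The branch homomorphisms `b_*` commute with transport along equalities of branches and vertices.
[cite: MochizukiSemiAnbd2006, Def. 2.1 p.23] -/
theorem brHom_castGe {b₁ b₂ : X.graph.Branch} {v₁ v₂ : X.graph.Vertex} (hb : b₁ = b₂) (hv : v₁ = v₂)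
    (h₁ : X.graph.abuts b₁ = some v₁) (h₂ : X.graph.abuts b₂ = some v₂) (x : X.Ge (X.graph.edgeOf b₁)) :
    X.brHom b₂ v₂ h₂ (X.castGe (congrArg X.graph.edgeOf hb) x) = X.castGv hv (X.brHom b₁ v₁ h₁ x) := by
  subst hb; subst hv; rfl

/-- A family of 2-cells is compatible with transport along equalities of branches and vertices.
[cite: MochizukiSemiAnbd2006, Rmk 2.4.2 p.26] -/
theorem Hom.ConjugatorFamily.castGv_θ {F : Hom X Y} (θ : F.ConjugatorFamily) {b₁ b₂ : X.graph.Branch}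
    {v₁ v₂ : X.graph.Vertex} (hb : b₁ = b₂) (hv : v₁ = v₂) (h₁ : X.graph.abuts b₁ = some v₁)
    (h₂ : X.graph.abuts b₂ = some v₂) :
    Y.castGv (congrArg F.base.vertexMap hv) (θ.θ b₁ v₁ h₁) = θ.θ b₂ v₂ h₂ := by
  subst hb; subst hv; rfl

/-- **The compatibility of `F` with the branch maps, read at arbitrary targets**: for a branch `b'` of
`X` abutting to `v'` and `b = F b'`, `w = F v'`, the square `F_{v'} ∘ b'_* = γ_θ ∘ b_* ∘ F_{e'}`
transported into `Π_{Y,w}`. [cite: MochizukiSemiAnbd2006, Rmk 2.4.2 p.26] -/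
theorem Hom.ConjugatorFamily.comm_cast {F : Hom X Y} (θ : F.ConjugatorFamily) (b' : X.graph.Branch)
    (v' : X.graph.Vertex) (h' : X.graph.abuts b' = some v') {b : Y.graph.Branch} {w : Y.graph.Vertex}
    (hb : F.base.branchMap b' = b) (hw : F.base.vertexMap v' = w) (h : Y.graph.abuts b = some w)
    (x : X.Ge (X.graph.edgeOf b')) :
    Y.castGv hw (F.hV v' (X.brHom b' v' h' x)) =
      Y.castGv hw (θ.θ b' v' h') *
        Y.brHom b w h (Y.castGe ((F.base.edgeOf_branchMap b').symm.trans (congrArg Y.graph.edgeOf hb))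
          (F.hE (X.graph.edgeOf b') x)) * (Y.castGv hw (θ.θ b' v' h'))⁻¹ := by
  subst hb; subst hw
  have hs := θ.spec b' v' h' x
  change θ.θ b' v' h' * Y.brHomAt (F.base.branchMap b') (F.base.vertexMap v')
      (F.base.abuts_branchMap b' v' h') _ (F.base.edgeOf_branchMap b') (F.hE (X.graph.edgeOf b') x) *
      (θ.θ b' v' h')⁻¹ = F.hV v' (X.brHom b' v' h' x) at hs
  rw [brHomAt_apply, eqRec_eq_castGe (F.base.edgeOf_branchMap b')] at hs
  simpa only [castGv_rfl] using hs.symm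

/-! ### Transport of points of the fibres of an object of `B^cov` -/

namespace CovObj

variable {P : ProfiniteSemiGraph.{u}} (S : CovObj P)

/-- Transport of points of the vertex fibres of `S` along an equality of vertices (companion of
abc-iut-L3-t3's `CovObj.castPtE`). [cite: MochizukiSemiAnbd2006, Def 3.5(i) p.37] -/
def castPtV {v₁ v₂ : P.graph.Vertex} (h : v₁ = v₂) (x : (S.SV v₁).obj.V) : (S.SV v₂).obj.V :=
  cast (congrArg (fun v => ((S.SV v).obj.V : Type u)) h) x

/-- Transport along `rfl` is the identity. [cite: MochizukiSemiAnbd2006, Def 3.5(i) p.37] -/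
@[simp] theorem castPtV_rfl (v : P.graph.Vertex) (x : (S.SV v).obj.V) : S.castPtV rfl x = x := rfl

/-- Composite of two transports of vertex points. [cite: MochizukiSemiAnbd2006, Def 3.5(i) p.37] -/
@[simp] theorem castPtV_castPtV {v₁ v₂ v₃ : P.graph.Vertex} (h₁ : v₁ = v₂) (h₂ : v₂ = v₃)
    (x : (S.SV v₁).obj.V) : S.castPtV h₂ (S.castPtV h₁ x) = S.castPtV (h₁.trans h₂) x := by
  subst h₁; subst h₂; rfl

/-- Composite of two transports of edge points. [cite: MochizukiSemiAnbd2006, Def 3.5(i) p.37] -/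
@[simp] theorem castPtE_castPtE {e₁ e₂ e₃ : P.graph.Edge} (h₁ : e₁ = e₂) (h₂ : e₂ = e₃)
    (x : (S.SE e₁).obj.V) : S.castPtE h₂ (S.castPtE h₁ x) = S.castPtE (h₁.trans h₂) x := by
  subst h₁; subst h₂; rfl

/-- Transport of vertex points is compatible with the actions (transported by `castGv`).
[cite: MochizukiSemiAnbd2006, Def 3.5(i) p.37] -/
theorem castPtV_ρ {v₁ v₂ : P.graph.Vertex} (h : v₁ = v₂) (g : P.Gv v₁) (x : (S.SV v₁).obj.V) :
    S.castPtV h ((S.SV v₁).obj.ρ g x) = (S.SV v₂).obj.ρ (P.castGv h g) (S.castPtV h x) := by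
  subst h; rfl

/-- `Eq.rec` in the vertex fibres is transport. [cite: MochizukiSemiAnbd2006, Def 3.5(i) p.37] -/
theorem eqRec_eq_castPtV {v₁ v₂ : P.graph.Vertex} (h : v₁ = v₂) (x : (S.SV v₂).obj.V) :
    (h ▸ x : (S.SV v₁).obj.V) = S.castPtV h.symm x := by
  subst h; rfl

/-- `Eq.rec` in the edge fibres is transport. [cite: MochizukiSemiAnbd2006, Def 3.5(i) p.37] -/
theorem eqRec_eq_castPtE {e₁ e₂ : P.graph.Edge} (h : e₁ = e₂) (x : (S.SE e₂).obj.V) :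
    (h ▸ x : (S.SE e₁).obj.V) = S.castPtE h.symm x := by
  subst h; rfl

/-- `Equiv.cast` in the vertex fibres is transport. [cite: MochizukiSemiAnbd2006, Def 3.5(i) p.37] -/
theorem equivCast_apply_eq_castPtV {v₁ v₂ : P.graph.Vertex} (h : v₁ = v₂) (x : (S.SV v₁).obj.V) :
    Equiv.cast (congrArg (fun v => ((S.SV v).obj.V : Type u)) h) x = S.castPtV h x := rfl

/-- `Equiv.cast` in the edge fibres is transport. [cite: MochizukiSemiAnbd2006, Def 3.5(i) p.37] -/
theorem equivCast_apply_eq_castPtE {e₁ e₂ : P.graph.Edge} (h : e₁ = e₂) (x : (S.SE e₁).obj.V) :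
    Equiv.cast (congrArg (fun e => ((S.SE e).obj.V : Type u)) h) x = S.castPtE h x := rfl

/-- Morphisms of `B^cov` commute with transport of vertex points. [cite: MochizukiSemiAnbd2006, §3 p.36] -/
theorem castPtV_fV {S T : CovObj P} (f : S ⟶ T) {v₁ v₂ : P.graph.Vertex} (h : v₁ = v₂)
    (x : (S.SV v₁).obj.V) :
    T.castPtV h ((f.fV v₁).hom.hom x) = (f.fV v₂).hom.hom (S.castPtV h x) := by
  subst h; rfl

/-- Morphisms of `B^cov` commute with transport of edge points. [cite: MochizukiSemiAnbd2006, §3 p.36] -/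
theorem castPtE_fE {S T : CovObj P} (f : S ⟶ T) {e₁ e₂ : P.graph.Edge} (h : e₁ = e₂)
    (x : (S.SE e₁).obj.V) :
    T.castPtE h ((f.fE e₁).hom.hom x) = (f.fE e₂).hom.hom (S.castPtE h x) := by
  subst h; rfl

/-- **The gluings commute with transport** along equalities of branches and vertices.
[cite: MochizukiSemiAnbd2006, §3 p.36] -/
theorem castPtV_glue {b₁ b₂ : P.graph.Branch} {v₁ v₂ : P.graph.Vertex} (hb : b₁ = b₂) (hv : v₁ = v₂)
    (h₁ : P.graph.abuts b₁ = some v₁) (h₂ : P.graph.abuts b₂ = some v₂)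
    (x : (S.SE (P.graph.edgeOf b₁)).obj.V) :
    S.castPtV hv ((S.glue b₁ v₁ h₁).hom.hom.hom x) =
      (S.glue b₂ v₂ h₂).hom.hom.hom (S.castPtE (congrArg P.graph.edgeOf hb) x) := by
  subst hb; subst hv; rfl

/-- Transport of edge points of a pull-back `F^*_θ S` is transport of edge points of `S` along the
image equality. [cite: MochizukiSemiAnbd2006, Prop 3.6(iv) p.39] -/
theorem castPtE_covPullbackWith (F : Hom X Y) (θ : F.ConjugatorFamily) (S : CovObj Y)
    {e₁ e₂ : X.graph.Edge} (h : e₁ = e₂) (x : (S.SE (F.base.edgeMap e₁)).obj.V) :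
    ((F.covPullbackWith θ).obj S).castPtE h x = S.castPtE (congrArg F.base.edgeMap h) x := by
  subst h; rfl

/-- Transport of vertex points of a pull-back `F^*_θ S` is transport of vertex points of `S` along the
image equality. [cite: MochizukiSemiAnbd2006, Prop 3.6(iv) p.39] -/
theorem castPtV_covPullbackWith (F : Hom X Y) (θ : F.ConjugatorFamily) (S : CovObj Y)
    {v₁ v₂ : X.graph.Vertex} (h : v₁ = v₂) (x : (S.SV (F.base.vertexMap v₁)).obj.V) :
    ((F.covPullbackWith θ).obj S).castPtV h x = S.castPtV (congrArg F.base.vertexMap h) x := by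
  subst h; rfl

end CovObj

end ProfiniteSemiGraph

end Literature.AnabelianGeometry.SemiGraphs

end
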